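import Summits.QuantumFields.QCD.Theorems.QuarksAsStableActionStableActionBridgeCyclicSupertrace
import Summits.QuantumFields.QCD.Theorems.QuarksAsStableActionStableActionBridgeDiracMatrixSupertrace

/-!
# The `N_f`-flavour lattice-QCD Boltzmann integral as a cyclic kernel supertrace
(crux `QuarksAsStableAction.StableActionBridge`, item stmt-QuantumFields-9737, line `Sketch`;
registered stub `qcd_boltzmann_integral_eq_cyclic_supertrace_flavour`, the `N_f`-flavour version of
capstone C of the F3 dictionary)

For `N_f` flavours of `r = 1` Wilson quarks of bare masses `m_f > −1` in the fundamental
representation of `SU(3)` on the four-torus `(ℤ/N)⁴` (`N ≥ 1`), the Boltzmann integral of lattice QCD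
over the product Haar measure of the links, with the STATEMENT's flavour-diagonal Wilson–Dirac matrix
`D(U) = diracMatrix U mq = ⊕_f D_W[U; m_f]` (Montvay–Münster §5.1),

  `Z = ∫ e^{−β S_W(U)} det D(U) ∏_e dU_e`,

equals the CYCLIC KERNEL SUPERTRACE of `N` projected transfer kernels over the `N_f`-flavour slice
Fock space: slicing the torus across Euclidean time (spatial links `Us t`, temporal links `gs t`
leaving slice `t`),

  `Z = ∫∫ ∏_t K_β(Us t, (Us (t+1))^{gs t}) · STr ∏_t T̂_F(Us t) Γ(G_{gs t}) ∏_t dUs_t ∏_t dgs_t`,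

with `K_β` the temporal-gauge transfer kernel of the gauge field (`gaugeSliceKernel`, Smit (4.121),
(4.129)), `T̂_F` Smit's `N_f`-flavour fermionic transfer operator (`fermionSliceOp`, Smit (6.91)),
`Γ(G_g)` the Fock-space gauge rotation (`fockGaugeAct`, Smit (4.125)–(4.127)) and
`STr X = Σ_s (−1)^{#s} X_{ss}` (periodic time for the fermions).  NO gauge fixing is used: the
temporal links, put back as gauge transformations of the next slice and integrated against Haar, ARE
the Gauss-law projections `P̂₀` (Smit (4.137)), so this is Lüscher's `Z = Tr (𝕋 P̂₀)^N` at kernel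
level (Lüscher 1977; Osterwalder–Seiler 1978 §2).

Assembly: identical to the one-flavour capstone C (`qcd_boltzmann_integral_eq_cyclic_supertrace`):
the Yang–Mills time-slicing theorem `stub_timeSlicing` (the assembling map `(Us, gs) ↦ U` is measure
preserving from the product of the slice Haar measures to the torus Haar measure), the flavour-blind
identification of the Boltzmann weight of the assembled field with the telescoped cyclic kernel
product (`CyclicSupertrace.exp_wilsonAction_timeAssemble`), and the `N_f`-flavour capstone B
`det_diracMatrix_eq_supertrace_fermionSliceOp` (Lüscher's supertrace formula for `det D(U)`) read
through the slicing dictionary; the integrand is continuous (`continuous_det_diracMatrix`), so the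
integral is transported along the assembling map (`integral_map`).  Pure theorem file (no
definitions).

References: M. Lüscher, Commun. Math. Phys. 54 (1977) 283 [Luscher1977, pp. 283–292];
K. Osterwalder, E. Seiler, Ann. Phys. 110 (1978) 440 [OsterwalderSeiler1978, §2]; J. Smit,
*Introduction to Quantum Fields on a Lattice* [Smit2023, §4.6 (4.127)–(4.137), §6.5 (6.87)–(6.91)];
I. Montvay and G. Münster, *Quantum Fields on a Lattice*, §5.1 [MontvayMunster1994, §5.1].
-/

noncomputable section

namespace Summit.QuantumFields.QCD.Cruxes.StableActionBridge.Sketch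

open MeasureTheory Matrix Literature.MathematicalPhysics.QuantumFieldTheory
  Literature.MathematicalPhysics.QuantumLattice
open Literature.Probability.LatticeModels (TorusSite)

namespace CyclicSupertraceFlavour

/-- **The `N_f`-flavour fermion determinant of the assembled field is the supertrace of the slice
data.**  For the four-torus field assembled from spatial slices `Us t` and temporal links `gs t`,
`det D(U) = Σ_s (−1)^{#s} ⟨s| ∏_{i<N} T̂_F(Us i) Γ(G_{gs i}) |s⟩` (the `N_f`-flavour capstone B read
through the slicing dictionary). [cite: Luscher1977, pp. 283–292] [cite: Smit2023, §6.5 (6.87)–(6.91)]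
[cite: MontvayMunster1994, §5.1] -/
theorem det_diracMatrix_timeAssemble (Nf N : ℕ) [NeZero N]
    (Us : ZMod N → GaugeConfig 3 N (Matrix.specialUnitaryGroup (Fin 3) ℂ))
    (gs : ZMod N → TorusSite 3 N → Matrix.specialUnitaryGroup (Fin 3) ℂ) (mq : Fin Nf → ℝ)
    (hm : ∀ f, -1 < mq f) :
    (diracMatrix
        (fun e : Edge 4 N =>
          (Fin.cons (gs (e.1 0) (Fin.tail e.1)) (fun i : Fin 3 => Us (e.1 0) (Fin.tail e.1, i)) :
            Fin 4 → Matrix.specialUnitaryGroup (Fin 3) ℂ) e.2) mq).det =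
      ∑ s : Finset (SliceFermiIdx Nf N), (-1 : ℂ) ^ s.card *
        (((List.range N).map fun i : ℕ =>
            fermionSliceOp (Us (i : ZMod N)) mq *
              fockGaugeAct (Nf := Nf) (gs (i : ZMod N))).prod) s s := by
  rw [det_diracMatrix_eq_supertrace_fermionSliceOp Nf N _ mq hm]
  simp only [Fin.cons_succ, Fin.cons_zero, Fin.tail_cons, Prod.mk.eta]

/-- **Pointwise identity behind the `N_f`-flavour capstone C.**  At the field assembled from
`p = (Us, gs)` the `N_f`-flavour QCD Boltzmann integrand `e^{−β S_W(U)} det D(U)` is the cyclic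
kernel product times the supertrace of the time-ordered product of projected fermionic transfer
operators,
`(∏_t K_β(Us t, (Us (t+1))^{gs t})) · Σ_s (−1)^{#s} ⟨s| ∏_{i<N} T̂_F(Us i) Γ(G_{gs i}) |s⟩`.
[cite: Luscher1977, pp. 283–292] [cite: Smit2023, §4.6 (4.127)–(4.137), §6.5 (6.87)–(6.91)]
[cite: MontvayMunster1994, §5.1] -/
theorem integrand_timeAssemble (Nf N : ℕ) [NeZero N] (β : ℝ) (mq : Fin Nf → ℝ)
    (hm : ∀ f, -1 < mq f)
    (p : (ZMod N → GaugeConfig 3 N (Matrix.specialUnitaryGroup (Fin 3) ℂ)) ×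
      (ZMod N → TorusSite 3 N → Matrix.specialUnitaryGroup (Fin 3) ℂ)) :
    (Real.exp (-(β * wilsonAction (fundamentalRep (Fin 3))
        (fun e : Edge 4 N =>
          (Fin.cons (p.2 (e.1 0) (Fin.tail e.1)) (fun i : Fin 3 => p.1 (e.1 0) (Fin.tail e.1, i)) :
            Fin 4 → Matrix.specialUnitaryGroup (Fin 3) ℂ) e.2))) : ℂ) *
        (diracMatrix
          (fun e : Edge 4 N =>
            (Fin.cons (p.2 (e.1 0) (Fin.tail e.1)) (fun i : Fin 3 => p.1 (e.1 0) (Fin.tail e.1, i)) :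
              Fin 4 → Matrix.specialUnitaryGroup (Fin 3) ℂ) e.2) mq).det =
      ((∏ t : ZMod N, gaugeSliceKernel β (p.1 t) (gaugeTransform (p.2 t) (p.1 (t + 1))) : ℝ) : ℂ) *
        ∑ s : Finset (SliceFermiIdx Nf N), (-1 : ℂ) ^ s.card *
          (((List.range N).map fun i : ℕ =>
              fermionSliceOp (p.1 (i : ZMod N)) mq *
                fockGaugeAct (Nf := Nf) (p.2 (i : ZMod N))).prod) s s := by
  rw [CyclicSupertrace.exp_wilsonAction_timeAssemble N β p.1 p.2,
    det_diracMatrix_timeAssemble Nf N p.1 p.2 mq hm]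

/-- The `N_f`-flavour QCD Boltzmann integrand `U ↦ e^{−β S_W(U)} det D(U)` is continuous on the
compact configuration space `SU(3)^{edges}` (the Wilson action and the flavour-diagonal Wilson–Dirac
matrix are continuous in the links). [folklore] -/
theorem continuous_integrand (Nf N : ℕ) [NeZero N] (β : ℝ) (mq : Fin Nf → ℝ) :
    Continuous fun U : GaugeConfig 4 N (Matrix.specialUnitaryGroup (Fin 3) ℂ) =>
      (Real.exp (-(β * wilsonAction (fundamentalRep (Fin 3)) U)) : ℂ) * (diracMatrix U mq).det :=
  (Complex.continuous_ofReal.comp (Real.continuous_exp.comp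
    (((Literature.MathematicalPhysics.QuantumFieldTheory.continuous_wilsonAction
      (fundamentalRep (Fin 3)) (continuous_fundamentalRep (Fin 3))).const_mul β).neg))).mul
    (continuous_det_diracMatrix (S := N) mq)

end CyclicSupertraceFlavour

/-- **The `N_f`-flavour capstone C of the F3 dictionary (stub
`qcd_boltzmann_integral_eq_cyclic_supertrace_flavour` of line `Sketch`): the lattice-QCD Boltzmann
integral is a cyclic kernel supertrace.**  For `N_f` flavours of `r = 1` Wilson quarks of bare
masses `m_f > −1` (fundamental representation of `SU(3)`) on the four-torus `(ℤ/N)⁴`, with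
`D(U) = diracMatrix U mq` the flavour-diagonal Wilson–Dirac matrix,
`∫ e^{−β S_W(U)} det D(U) dU = ∫∫ ∏_t K_β(Us t, (Us (t+1))^{gs t}) · STr ∏_t T̂_F(Us t) Γ(G_{gs t}) dUs dgs`:
Lüscher's `Z = Tr (𝕋 P̂₀)^N` at kernel level, without gauge fixing — the Haar integrals over the
temporal links `gs t` are the Gauss-law projections `P̂₀`.
[cite: Luscher1977, pp. 283–292] [cite: OsterwalderSeiler1978, §2]
[cite: Smit2023, §4.6 (4.127)–(4.137), §6.5 (6.87)–(6.91)] [cite: MontvayMunster1994, §5.1] -/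
theorem qcd_boltzmann_integral_eq_cyclic_supertrace_flavour : ∀ (Nf N : ℕ) [NeZero N] (β : ℝ) (mq : Fin Nf → ℝ), (∀ f, -1 < mq f) → ∫ U : GaugeConfig 4 N (Matrix.specialUnitaryGroup (Fin 3) ℂ), (Real.exp (-(β * wilsonAction (fundamentalRep (Fin 3)) U)) : ℂ) * (diracMatrix U mq).det ∂(Measure.pi fun _ : Edge 4 N => haarProbability (Matrix.specialUnitaryGroup (Fin 3) ℂ)) = ∫ p : (ZMod N → GaugeConfig 3 N (Matrix.specialUnitaryGroup (Fin 3) ℂ)) × (ZMod N → TorusSite 3 N → Matrix.specialUnitaryGroup (Fin 3) ℂ), ((∏ t : ZMod N, gaugeSliceKernel β (p.1 t) (gaugeTransform (p.2 t) (p.1 (t + 1))) : ℝ) : ℂ) * ∑ s : Finset (SliceFermiIdx Nf N), (-1 : ℂ) ^ s.card * (((List.range N).map fun i : ℕ => fermionSliceOp (p.1 (i : ZMod N)) mq * fockGaugeAct (Nf := Nf) (p.2 (i : ZMod N))).prod) s s ∂((Measure.pi fun _ : ZMod N => Measure.pi fun _ : Edge 3 N => haarProbability (Matrix.specialUnitaryGroup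 (Fin 3) ℂ)).prod (Measure.pi fun _ : ZMod N => Measure.pi fun _ : TorusSite 3 N => haarProbability (Matrix.specialUnitaryGroup (Fin 3) ℂ))) := by
  intro Nf N _ β mq hm
  -- T1: the assembling map `(Us, gs) ↦ U` is measure preserving (slice Haar ↦ torus Haar)
  obtain ⟨hasm, -⟩ :=
    Summit.QuantumFields.YangMills.Theorems.WeakCouplingHypercubicLimit.TraceNormColdPressure.stub_timeSlicing
      N (Matrix.specialUnitaryGroup (Fin 3) ℂ) (fundamentalRep (Fin 3))
  -- transport the torus integral along the assembling map
  rw [← hasm.map_eq, integral_map hasm.measurable.aemeasurable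
    (CyclicSupertraceFlavour.continuous_integrand Nf N β mq).aestronglyMeasurable]
  -- and identify the integrands pointwise
  exact integral_congr_ae (ae_of_all _ fun p =>
    CyclicSupertraceFlavour.integrand_timeAssemble Nf N β mq hm p)

end Summit.QuantumFields.QCD.Cruxes.StableActionBridge.Sketch

end
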